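import Literature.Analysis.FluidPDE.ClassicalDriftNSLocalEnergy
import HarnessLib

/-!
# The local energy identity of the caloric remainder of a classical Navier–Stokes solution

Analysis/FluidPDE support file (theorems only, no definitions, no named facts) on the discharge
path of `Literature.Analysis.FluidPDE.GIP2003_L3_stability` (Gallagher–Iftimie–Planchon 2003,
Thm. 0.1 (i) = Thm. 2.1 in `L³`: decay of a priori global `C_t(L³)` solutions). GIP prove the
decay by an energy estimate for the difference `v = u - w` of the solution and a small solution
`w` (proof of Thm. 2.1, (7)–(8), pp. 1396–1397, with the method of C. Calderón). On the tree's
discharge path the background is the *caloric* extension `e = e^{tΔ}w₀` of the small part of the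
datum (Calderón 1990, §1; Lemarié-Rieusset 2016, Prop. 15.1 and proof of Thm. 14.7,
pp. 515–516: the balance `∂ₜ(|w|²/2) = νΔ(|w|²/2) - ν|∇w|² - div(q w) - A - μ` for the difference
of a suitable and a regular solution), and the energy computation is carried out for the
classical representative of the mild solution at positive times. This file proves the classical
core of that computation, in a general finite-dimensional inner product space `E`:

* `GIP2003.integral_mul_inner_fderiv_apply_eq` — the integration-by-parts pattern
  `∫ φ⟪a, Dc(b)⟫ = -∫ ⟪a, c⟫⟪b, ∇φ⟫ - ∫ φ⟪Da(b), c⟫` for `C¹` fields with `div b = 0` on `{φ ≠ 0}`;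
* `GIP2003.remainder_slice_identity` — the slice identity for `v = u - e`: if
  `∂ₜu + (u·∇)u = νΔu - ∇p`, `div u = 0`, `∂ₜe = νΔe` pointwise, then against `φ ∈ C²_c`
  `∫ 2φ⟪v, ∂ₜv⟫ = ∫ |v|²⟪u, ∇φ⟫ - 2ν∫⟪Dv(∇φ), v⟫ - 2ν∫ φ|Dv|² + 2∫ p⟪v, ∇φ⟫ - 2∫ φ⟪v, De(u)⟫`
  (the tree's drift slice identity `integral_two_mul_inner_eq_of_drift_momentum` applied with
  `W = ∂ₜv + (u·∇)e`);
* `GIP2003.remainder_coupling_expansion` — the coupling term expanded by `u = v + e` with the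
  pattern above (`div v = div e = 0`):
  `-2∫ φ⟪v, De(u)⟫ = 2∫ ⟪v,e⟫⟪v,∇φ⟫ + 2∫ φ⟪Dv(v), e⟫ + 2∫ ⟪v,e⟫⟪e,∇φ⟫ + 2∫ φ⟪Dv(e), e⟫`;
* `GIP2003.remainder_local_energy_identity` — the space–time form on `[s, t] ⊆ S` (`S` open):
  `∫ φ|v(t)|² - ∫ φ|v(s)|² = ∫ₛᵗ (slice right-hand side) dτ`
  (`integral_mul_norm_sq_sub_eq_integral_Ioo`).

## References

* I. Gallagher, D. Iftimie, F. Planchon, Ann. Inst. Fourier 53 (2003), proof of Thm. 2.1,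
  (7)–(8), pp. 1396–1397. [GallagherIftimiePlanchon2003]
* P. G. Lemarié-Rieusset, *The Navier–Stokes Problem in the 21st Century*, CRC Press 2016,
  Prop. 15.1; proof of Thm. 14.7, pp. 515–516. [LemarieRieusset2016]
* C. P. Calderón, Trans. AMS 318 (1990) 179–200, §1. [Calderon1990]
-/

noncomputable section

open MeasureTheory TopologicalSpace Set Function Filter InnerProductSpace
open scoped ENNReal NNReal Laplacian RealInnerProductSpace ContDiff Topology

namespace Literature.Analysis.FluidPDE

namespace GIP2003

/-! ### The integration-by-parts pattern -/

section Slice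

variable {E : Type*} [NormedAddCommGroup E] [InnerProductSpace ℝ E] [FiniteDimensional ℝ E]
  [MeasurableSpace E] [BorelSpace E]

/-- **Integration-by-parts pattern**: for `C¹` fields `a`, `b`, `c` on `E`, `φ ∈ C¹_c` and
`div b = 0` on `{φ ≠ 0}`,
`∫ φ⟪a, Dc(b)⟫ = -∫ ⟪a, c⟫⟪b, ∇φ⟫ - ∫ φ⟪Da(b), c⟫`
(apply `∫ θ div b + ∫ ⟪b, ∇θ⟫ = 0` to `θ = φ⟪a, c⟫`). [folklore] -/
theorem integral_mul_inner_fderiv_apply_eq {a b c : E → E} {φ : E → ℝ} (ha : ContDiff ℝ 1 a)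
    (hb : ContDiff ℝ 1 b) (hc : ContDiff ℝ 1 c) (hφ : ContDiff ℝ 1 φ) (hφc : HasCompactSupport φ)
    (hdivb : ∀ x, φ x ≠ 0 → VectorCalculus.divergence b x = 0) :
    ∫ x, φ x * ⟪a x, fderiv ℝ c x (b x)⟫ =
      -(∫ x, ⟪a x, c x⟫ * ⟪b x, gradient φ x⟫) - ∫ x, φ x * ⟪fderiv ℝ a x (b x), c x⟫ := by
  have hda : ∀ x, DifferentiableAt ℝ a x := fun x => ha.differentiable one_ne_zero x
  have hdc : ∀ x, DifferentiableAt ℝ c x := fun x => hc.differentiable one_ne_zero x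
  have hdφ : ∀ x, DifferentiableAt ℝ φ x := fun x => hφ.differentiable one_ne_zero x
  have hac : ContDiff ℝ 1 fun x => ⟪a x, c x⟫ := ha.inner ℝ hc
  have hdac : ∀ x, DifferentiableAt ℝ (fun y => ⟪a y, c y⟫) x := fun x =>
    hac.differentiable one_ne_zero x
  have hθ : ContDiff ℝ 1 fun x => φ x * ⟪a x, c x⟫ := hφ.mul hac
  have hθc : HasCompactSupport fun x => φ x * ⟪a x, c x⟫ := hφc.mul_right
  -- `∫ θ div b + ∫ ⟪b, ∇θ⟫ = 0`
  have h := integral_mul_divergence_add_eq_zero_left hθ hb hθc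
  have hl : ∀ x, φ x * ⟪a x, c x⟫ * VectorCalculus.divergence b x = 0 := fun x => by
    by_cases hx : φ x = 0
    · simp [hx]
    · rw [hdivb x hx, mul_zero]
  have hr : ∀ x, ⟪b x, gradient (fun y => φ y * ⟪a y, c y⟫) x⟫ =
      ⟪a x, c x⟫ * ⟪b x, gradient φ x⟫ +
        (φ x * ⟪fderiv ℝ a x (b x), c x⟫ + φ x * ⟪a x, fderiv ℝ c x (b x)⟫) := fun x => by
    rw [inner_gradient_right_eq_fderiv, fderiv_fun_mul (hdφ x) (hdac x)]
    show φ x • fderiv ℝ (fun y => ⟪a y, c y⟫) x (b x) + ⟪a x, c x⟫ • fderiv ℝ φ x (b x) = _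
    rw [smul_eq_mul, smul_eq_mul, fderiv_inner_apply ℝ (hda x) (hdc x),
      ← inner_gradient_right_eq_fderiv]
    ring
  rw [integral_congr_ae (Eventually.of_forall hl), integral_zero, zero_add,
    integral_congr_ae (Eventually.of_forall hr)] at h
  -- integrability of the three pieces
  have i1 : Integrable (fun x => ⟪a x, c x⟫ * ⟪b x, gradient φ x⟫) (volume : Measure E) := by
    refine integrable_of_continuous_of_tsupport ?_ hφc fun x hx => ?_
    · exact hac.continuous.mul (hb.continuous.inner (continuous_gradient_of_contDiff hφ))
    · simp [gradient_eq_zero_of_notMem_tsupport hx]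
  have i2 : Integrable (fun x => φ x * ⟪fderiv ℝ a x (b x), c x⟫) (volume : Measure E) := by
    refine integrable_of_continuous_of_tsupport ?_ hφc fun x hx => ?_
    · exact hφ.continuous.mul ((isBoundedBilinearMap_apply.continuous.comp
        ((ha.continuous_fderiv one_ne_zero).prodMk hb.continuous)).inner hc.continuous)
    · simp [image_eq_zero_of_notMem_tsupport hx]
  have i3 : Integrable (fun x => φ x * ⟪a x, fderiv ℝ c x (b x)⟫) (volume : Measure E) := by
    refine integrable_of_continuous_of_tsupport ?_ hφc fun x hx => ?_
    · exact hφ.continuous.mul (ha.continuous.inner (isBoundedBilinearMap_apply.continuous.comp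
        ((hc.continuous_fderiv one_ne_zero).prodMk hb.continuous)))
    · simp [image_eq_zero_of_notMem_tsupport hx]
  have i23 : Integrable (fun x => φ x * ⟪fderiv ℝ a x (b x), c x⟫ +
      φ x * ⟪a x, fderiv ℝ c x (b x)⟫) (volume : Measure E) := i2.add i3
  rw [integral_add i1 i23, integral_add i2 i3] at h
  linarith

/-- **The slice identity for the caloric remainder.** Let `V, U ∈ C²(E; E)`, `e ∈ C²(E; E)`,
`P ∈ C¹`, `φ ∈ C²_c`, and fields `Wu, We : E → E` (think `∂ₜu(t)`, `∂ₜe(t)`) with, on `{φ ≠ 0}`,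
`Wu + (U·∇)U = νΔU - ∇P`, `div U = 0`, `We = νΔe`, and `V = U - e`. Then
`∫ 2φ⟪V, Wu - We⟫ = ∫ |V|²⟪U, ∇φ⟫ - 2ν∫⟪DV(∇φ), V⟫ - 2ν∫ φ|DV|² + 2∫ P⟪V, ∇φ⟫ - 2∫ φ⟪V, De(U)⟫`
(the drift slice identity `integral_two_mul_inner_eq_of_drift_momentum` with drift `U` and
`W = (Wu - We) + (U·∇)e`; GIP 2003, proof of Thm. 2.1, (7)–(8); Lemarié-Rieusset 2016, proof of
Thm. 14.7, p. 516). [cite: GallagherIftimiePlanchon2003, Thm. 2.1 (proof, (7)–(8))] -/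
theorem remainder_slice_identity {ι : Type*} [Fintype ι] (bs : OrthonormalBasis ι ℝ E) {ν : ℝ}
    {U e Wu We : E → E} {P φ : E → ℝ}
    (hU : ContDiff ℝ 2 U) (he : ContDiff ℝ 2 e) (hP : ContDiff ℝ 1 P)
    (hφ : ContDiff ℝ 2 φ) (hφc : HasCompactSupport φ)
    (hmom : ∀ x, φ x ≠ 0 → Wu x + convect U U x = ν • (Δ U) x - gradient P x)
    (hheat : ∀ x, φ x ≠ 0 → We x = ν • (Δ e) x)
    (hdiv : ∀ x, φ x ≠ 0 → VectorCalculus.divergence U x = 0)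
    (hdive : ∀ x, φ x ≠ 0 → VectorCalculus.divergence e x = 0) :
    ∫ x, 2 * φ x * ⟪U x - e x, Wu x - We x⟫ =
      (∫ x, ‖U x - e x‖ ^ 2 * ⟪U x, gradient φ x⟫) -
        2 * ν * (∫ x, ⟪fderiv ℝ (fun y => U y - e y) x (gradient φ x), U x - e x⟫) -
        2 * ν * (∫ x, φ x * frobeniusNormSq (fderiv ℝ (fun y => U y - e y) x)) +
        2 * (∫ x, P x * ⟪U x - e x, gradient φ x⟫) -
        2 * ∫ x, φ x * ⟪U x - e x, fderiv ℝ e x (U x)⟫ := by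
  have hV : ContDiff ℝ 2 fun y => U y - e y := hU.sub he
  have hU1 : ContDiff ℝ 1 U := hU.of_le one_le_two
  have he1 : ContDiff ℝ 1 e := he.of_le one_le_two
  have hV1 : ContDiff ℝ 1 fun y => U y - e y := hV.of_le one_le_two
  have hdU : ∀ x, DifferentiableAt ℝ U x := fun x => hU1.differentiable one_ne_zero x
  have hde : ∀ x, DifferentiableAt ℝ e x := fun x => he1.differentiable one_ne_zero x
  -- the momentum equation of the remainder with `W = (Wu - We) + (U·∇)e`
  have hmomV : ∀ x, φ x ≠ 0 →
      (Wu x - We x + convect U e x) + convect U (fun y => U y - e y) x =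
        ν • (Δ (fun y => U y - e y)) x - gradient P x := by
    intro x hx
    have h1 := hmom x hx
    have h2 := hheat x hx
    have hlap : (Δ (fun y => U y - e y)) x = (Δ U) x - (Δ e) x :=
      ContDiffAt.laplacian_sub hU.contDiffAt he.contDiffAt
    have hconv : convect U (fun y => U y - e y) x = convect U U x - convect U e x := by
      simp only [convect_apply, fderiv_fun_sub (hdU x) (hde x)]
      rfl
    rw [hlap, hconv, smul_sub, h2]
    have : Wu x = ν • (Δ U) x - gradient P x - convect U U x := by rw [← h1]; abel
    rw [this]
    abel
  have hdivV : ∀ x, φ x ≠ 0 → VectorCalculus.divergence (fun y => U y - e y) x = 0 := by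
    intro x hx
    have h1 : VectorCalculus.divergence (fun y => U y - e y) x =
        VectorCalculus.divergence U x - VectorCalculus.divergence e x := by
      simp only [VectorCalculus.divergence, fderiv_fun_sub (hdU x) (hde x),
        ContinuousLinearMap.toLinearMap_sub, map_sub]
    rw [h1, hdiv x hx, hdive x hx, sub_zero]
  have hdrift := integral_two_mul_inner_eq_of_drift_momentum bs hV hU1 hP hφ hφc hmomV hdivV hdiv
  -- the continuous right-hand side `G = νΔV - ∇P - (U·∇)V` of the remainder equation
  have hcG : Continuous fun x => ν • (Δ (fun y => U y - e y)) x - gradient P x -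
      convect U (fun y => U y - e y) x := by
    refine ((continuous_const.smul (continuous_laplacian hV)).sub
      (continuous_gradient_of_contDiff hP)).sub ?_
    show Continuous fun x => fderiv ℝ (fun y => U y - e y) x (U x)
    exact isBoundedBilinearMap_apply.continuous.comp
      ((hV1.continuous_fderiv one_ne_zero).prodMk hU.continuous)
  have hAeq : (fun x => 2 * φ x * ⟪U x - e x, Wu x - We x + convect U e x⟫) = fun x =>
      2 * φ x * ⟪U x - e x, ν • (Δ (fun y => U y - e y)) x - gradient P x -
        convect U (fun y => U y - e y) x⟫ := by
    funext x
    by_cases hx : φ x = 0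
    · simp [hx]
    · rw [eq_sub_of_add_eq (hmomV x hx)]
  have iA : Integrable (fun x => 2 * φ x * ⟪U x - e x, Wu x - We x + convect U e x⟫)
      (volume : Measure E) := by
    rw [hAeq]
    exact ((continuous_const.mul hφ.continuous).mul ((hU.continuous.sub he.continuous).inner
      hcG)).integrable_of_hasCompactSupport (hφc.mul_left.mul_right)
  have hcB : Continuous fun x => 2 * φ x * ⟪U x - e x, convect U e x⟫ := by
    refine (continuous_const.mul hφ.continuous).mul ((hU.continuous.sub he.continuous).inner ?_)
    show Continuous fun x => fderiv ℝ e x (U x)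
    exact isBoundedBilinearMap_apply.continuous.comp
      ((he1.continuous_fderiv one_ne_zero).prodMk hU.continuous)
  have iB : Integrable (fun x => 2 * φ x * ⟪U x - e x, convect U e x⟫) (volume : Measure E) :=
    hcB.integrable_of_hasCompactSupport (hφc.mul_left.mul_right)
  have hsplit : ∫ x, 2 * φ x * ⟪U x - e x, Wu x - We x⟫ =
      (∫ x, 2 * φ x * ⟪U x - e x, Wu x - We x + convect U e x⟫) -
        ∫ x, 2 * φ x * ⟪U x - e x, convect U e x⟫ := by
    rw [← integral_sub iA iB]
    refine integral_congr_ae (Eventually.of_forall fun x => ?_)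
    simp only [inner_add_right]
    ring
  have hlast : ∫ x, 2 * φ x * ⟪U x - e x, convect U e x⟫ =
      2 * ∫ x, φ x * ⟪U x - e x, fderiv ℝ e x (U x)⟫ := by
    rw [← integral_const_mul]
    refine integral_congr_ae (Eventually.of_forall fun x => ?_)
    simp only [convect_apply]
    ring
  rw [hsplit, hdrift, hlast]

/-- **The coupling term expanded** (`u = v + e`, `div v = div e = 0` on `{φ ≠ 0}`; the terms
`A = w·((w·∇)u₁)` and the transport of `|u₁|²` in Lemarié-Rieusset 2016, proof of Thm. 14.7,
p. 516): for `C¹` fields `v`, `e` and `φ ∈ C¹_c`,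
`-2∫ φ⟪v, De(v + e)⟫ = 2∫ ⟪v,e⟫⟪v,∇φ⟫ + 2∫ φ⟪Dv(v), e⟫ + 2∫ ⟪v,e⟫⟪e,∇φ⟫ + 2∫ φ⟪Dv(e), e⟫`.
[cite: LemarieRieusset2016, Thm. 14.7 (proof, p. 516)] -/
theorem remainder_coupling_expansion {v e : E → E} {φ : E → ℝ} (hv : ContDiff ℝ 1 v)
    (he : ContDiff ℝ 1 e) (hφ : ContDiff ℝ 1 φ) (hφc : HasCompactSupport φ)
    (hdivv : ∀ x, φ x ≠ 0 → VectorCalculus.divergence v x = 0)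
    (hdive : ∀ x, φ x ≠ 0 → VectorCalculus.divergence e x = 0) :
    -2 * ∫ x, φ x * ⟪v x, fderiv ℝ e x (v x + e x)⟫ =
      2 * (∫ x, ⟪v x, e x⟫ * ⟪v x, gradient φ x⟫) + 2 * (∫ x, φ x * ⟪fderiv ℝ v x (v x), e x⟫) +
        2 * (∫ x, ⟪v x, e x⟫ * ⟪e x, gradient φ x⟫) +
        2 * ∫ x, φ x * ⟪fderiv ℝ v x (e x), e x⟫ := by
  have h1 := integral_mul_inner_fderiv_apply_eq hv hv he hφ hφc hdivv
  have h2 := integral_mul_inner_fderiv_apply_eq hv he he hφ hφc hdive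
  have hc1 : Continuous fun x => φ x * ⟪v x, fderiv ℝ e x (v x)⟫ :=
    hφ.continuous.mul (hv.continuous.inner (isBoundedBilinearMap_apply.continuous.comp
      ((he.continuous_fderiv one_ne_zero).prodMk hv.continuous)))
  have hc2 : Continuous fun x => φ x * ⟪v x, fderiv ℝ e x (e x)⟫ :=
    hφ.continuous.mul (hv.continuous.inner (isBoundedBilinearMap_apply.continuous.comp
      ((he.continuous_fderiv one_ne_zero).prodMk he.continuous)))
  have i1 : Integrable (fun x => φ x * ⟪v x, fderiv ℝ e x (v x)⟫) (volume : Measure E) :=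
    hc1.integrable_of_hasCompactSupport hφc.mul_right
  have i2 : Integrable (fun x => φ x * ⟪v x, fderiv ℝ e x (e x)⟫) (volume : Measure E) :=
    hc2.integrable_of_hasCompactSupport hφc.mul_right
  have hsum : ∫ x, φ x * ⟪v x, fderiv ℝ e x (v x + e x)⟫ =
      (∫ x, φ x * ⟪v x, fderiv ℝ e x (v x)⟫) + ∫ x, φ x * ⟪v x, fderiv ℝ e x (e x)⟫ := by
    rw [← integral_add i1 i2]
    refine integral_congr_ae (Eventually.of_forall fun x => ?_)
    simp only [map_add, inner_add_right]
    ring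
  rw [hsum, h1, h2]
  ring

end Slice

/-! ### The space–time identity -/

section SpaceTime

variable {E : Type*} [NormedAddCommGroup E] [InnerProductSpace ℝ E] [FiniteDimensional ℝ E]
  [MeasurableSpace E] [BorelSpace E]

/-- **The local energy identity of the caloric remainder of a classical solution** (space–time
form, spatial cutoff). Let `S ⊆ ℝ` be open, `(u, p)` a classical solution of the unforced
Navier–Stokes equations on `S × E` (`IsClassicalNSSolutionOn S ν 0 u p`), `e` a jointly smooth
field on `S × E` with `∂ₜe = νΔe` and `div e(t) = 0`, `[s, t] ⊆ S`, `φ ∈ C²_c(E)`. Then for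
`v = u - e`:
`∫ φ|v(t)|² - ∫ φ|v(s)|² = ∫ₛᵗ ( ∫ |v|²⟪u, ∇φ⟫ - 2ν∫⟪Dv(∇φ), v⟫ - 2ν∫ φ|Dv|² + 2∫ p⟪v, ∇φ⟫
  - 2∫ φ⟪v, De(u)⟫ ) dτ`
(GIP 2003, proof of Thm. 2.1, the energy estimate (8) for the difference, here against a cutoff
and with the caloric background; Lemarié-Rieusset 2016, proof of Thm. 14.7, pp. 515–516).
[cite: GallagherIftimiePlanchon2003, Thm. 2.1 (proof, (7)–(8), pp. 1396–1397)] [cite: LemarieRieusset2016, Thm. 14.7 (proof, pp. 515–516)] -/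
theorem remainder_local_energy_identity {ι : Type*} [Fintype ι] (bs : OrthonormalBasis ι ℝ E)
    {S : Set ℝ} {ν : ℝ} {u e : ℝ → E → E} {p : ℝ → E → ℝ}
    (h : IsClassicalNSSolutionOn S ν 0 u p) (hS : IsOpen S) (he : IsSmoothSpaceTimeOn S e)
    (hheat : ∀ t ∈ S, ∀ x, timeDeriv e t x = ν • (Δ (e t)) x)
    (hdive : ∀ t ∈ S, VectorCalculus.IsDivFree (e t))
    {φ : E → ℝ} (hφ : ContDiff ℝ 2 φ) (hφc : HasCompactSupport φ) {s t : ℝ} (hst : s ≤ t)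
    (hI : Icc s t ⊆ S) :
    (∫ x, φ x * ‖u t x - e t x‖ ^ 2) - (∫ x, φ x * ‖u s x - e s x‖ ^ 2) =
      ∫ τ in Ioo s t, ((∫ x, ‖u τ x - e τ x‖ ^ 2 * ⟪u τ x, gradient φ x⟫) -
        2 * ν * (∫ x, ⟪fderiv ℝ (fun y => u τ y - e τ y) x (gradient φ x), u τ x - e τ x⟫) -
        2 * ν * (∫ x, φ x * frobeniusNormSq (fderiv ℝ (fun y => u τ y - e τ y) x)) +
        2 * (∫ x, p τ x * ⟪u τ x - e τ x, gradient φ x⟫) -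
        2 * ∫ x, φ x * ⟪u τ x - e τ x, fderiv ℝ (e τ) x (u τ x)⟫) := by
  have hv : IsSmoothSpaceTimeOn S fun t x => u t x - e t x := h.smooth_velocity.sub he
  rw [integral_mul_norm_sq_sub_eq_integral_Ioo hv hS hφ.continuous hφc hst hI]
  refine setIntegral_congr_fun measurableSet_Ioo fun τ hτ => ?_
  have hτS : τ ∈ S := hI (Ioo_subset_Icc_self hτ)
  -- `∂ₜv = ∂ₜu - ∂ₜe` on the time lines
  have hdt : ∀ x, timeDeriv (fun t x => u t x - e t x) τ x = timeDeriv u τ x - timeDeriv e τ x := by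
    intro x
    simp only [timeDeriv_apply]
    exact ((h.smooth_velocity.hasDerivAt_timeLine hS hτS x).sub
      (he.hasDerivAt_timeLine hS hτS x)).deriv
  simp_rw [hdt]
  refine remainder_slice_identity bs
    ((h.smooth_velocity.contDiff_slice hτS).of_le (by norm_cast))
    ((he.contDiff_slice hτS).of_le (by norm_cast))
    ((h.smooth_pressure.contDiff_slice hτS).of_le (by norm_cast)) hφ hφc
    (fun x _ => ?_) (fun x _ => hheat τ hτS x) (fun x _ => h.divFree τ hτS x)
    (fun x _ => hdive τ hτS x)
  have hm := h.momentum τ hτS x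
  rw [timeDerivWithin_eq_deriv hS hτS] at hm
  rw [timeDeriv_apply, hm, Pi.zero_apply, Pi.zero_apply, add_zero]

end SpaceTime

end GIP2003

end Literature.Analysis.FluidPDE

end
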